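import Mathlib
import Summits.ValiantsHypothesis.ValiantsHypothesis.Theorems.LacunarySymmetroidMatrixDescartesCensusWindowFourWitnessMult

/-!
# `MatrixDescartes` census — WINDOW-4 POCKET ROWS I: the Euler twist `Φ = u·g − X·g′` controls `g/X^u` (with multiplicity)

HONEST FRAMING.  Object-search cell `pub-symmetroid`, door-A target `DoorA26 := PosRootLawAt 2 6 19`
(stmt-ValiantsHypothesis-19979; OPEN, typed, never asserted).  Necessary-condition rows about the four-term WINDOWS of HYPOTHETICAL
Descartes-sharp fewnomials; nothing here bounds any census count, kills any cell or bears on `MatrixDescartes`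
(stmt-ValiantsHypothesis-18050) / `VP ≠ VNP`.

First of four files typing the «window-4 POCKET ROW» of engine-2 g34's exact-tube instrument (memo `W4-COVERAGE-E2G34.md` §3,
desk R3098 (ii)): the exact three-root region of the alternating window 4-nomial `g = a − bX^u + cX^(u+v) − eX^(u+v+w)` beyond its two
circuit (triple) rows.  This file: the twist `Φ(y) = u·a − v·c·y^(u+v) + (v+w)·e·y^(u+v+w) = u·g(y) − y·g′(y) = −y^(u+1)·(g/X^u)′(y)`
vanishes at every positive MULTIPLE root of `g` (`fourNomial_twist_eq_zero_of_one_lt_rootMultiplicity`) and between any two positive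
roots (`fourNomial_exists_twist_zero_between_roots`, Rolle for `g/X^u`); `g/X^u` is monotone where `Φ ≤ 0` and antitone where `Φ ≥ 0`;
hence if all positive roots lie in an order-connected set where `Φ > 0`, `g` has at most ONE positive root counted with multiplicity
(`fourNomial_countP_posRoots_le_one_of_twist_pos`).  Related kernel work in coefficient coordinates and distinct-root currency: the T4
files `…CensusTetranomialStaircase/Window/Row/Branch/Chord` (val-sym-door-p4 g10).

[folklore] Rolle / monotonicity from the sign of a derivative; elementary.
-/

-- `Summit.ValiantsHypothesis.ValiantsHypothesis.…` repeats a component by the D-0017 layout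
-- (single-conjunct summit), which the `dupNamespace` linter flags; the name is mandated.
set_option linter.dupNamespace false

namespace Summit.ValiantsHypothesis.ValiantsHypothesis.Theorems.LacunarySymmetroidMatrixDescartes.Census

open Polynomial Finset Set
open scoped BigOperators Polynomial

/-- The window 4-nomial with `a ≠ 0` (and `u ≥ 1`) is not the zero polynomial: its value at `0` is `a`. [folklore] -/
theorem fourNomial_ne_zero {u v w : ℕ} (hu : 0 < u) {a : ℝ} (ha : a ≠ 0) (b c e : ℝ) :
    (C a - C b * X ^ u + C c * X ^ (u + v) - C e * X ^ (u + v + w) : ℝ[X]) ≠ 0 := by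
  intro h
  have h0 := congrArg (fun P : ℝ[X] => P.eval 0) h
  simp only [eval_fourNomial, eval_zero, zero_pow hu.ne', zero_pow (by omega : u + v ≠ 0),
    zero_pow (by omega : u + v + w ≠ 0), mul_zero, sub_zero, add_zero] at h0
  exact ha h0

/-- **At a positive MULTIPLE root of the window 4-nomial `g` the Euler twist `Φ = u·g − X·g′` vanishes.** [folklore] -/
theorem fourNomial_twist_eq_zero_of_one_lt_rootMultiplicity {u v w : ℕ} {a b c e x : ℝ} (hx : 0 < x)
    (h2 : 1 < (C a - C b * X ^ u + C c * X ^ (u + v) - C e * X ^ (u + v + w) : ℝ[X]).rootMultiplicity x) :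
    (u : ℝ) * a - (v : ℝ) * c * x ^ (u + v) + ((v : ℝ) + w) * e * x ^ (u + v + w) = 0 := by
  set P : ℝ[X] := C a - C b * X ^ u + C c * X ^ (u + v) - C e * X ^ (u + v + w) with hPdef
  have hg0 : a - b * x ^ u + c * x ^ (u + v) - e * x ^ (u + v + w) = 0 := by
    have h := isRoot_iterate_derivative_of_lt_rootMultiplicity (show 0 < P.rootMultiplicity x by omega)
    rw [Function.iterate_zero, id, IsRoot.def, hPdef, eval_fourNomial] at h
    exact h
  have hd0 : (derivative P).eval x = 0 := by
    have := isRoot_iterate_derivative_of_lt_rootMultiplicity h2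
    simpa using this
  have hxd : x * (derivative P).eval x
      = -(b * (u : ℝ) * x ^ u) + c * ((u : ℝ) + v) * x ^ (u + v) - e * ((u : ℝ) + v + w) * x ^ (u + v + w) := by
    rw [hPdef]; exact mul_eval_derivative_fourNomial a b c e u v w x
  rw [hd0, mul_zero] at hxd
  have hpw1 : x ^ (u + v) = x ^ u * x ^ v := pow_add x u v
  have hpw2 : x ^ (u + v + w) = x ^ u * x ^ (v + w) := by rw [add_assoc, pow_add]
  have hxu : 0 < x ^ u := pow_pos hx u
  nlinarith [hg0, hxd]

/-- **Twisted Rolle.**  Between two positive roots `x < x'` of the window 4-nomial `g` there is a zero of the Euler twist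
`Φ = u·g − X·g′` (Rolle for `g/X^u`, whose derivative is `−Φ/X^(u+1)`). [folklore] -/
theorem fourNomial_exists_twist_zero_between_roots {u v w : ℕ} (hu : 0 < u) {a b c e x x' : ℝ} (hx : 0 < x)
    (hxx' : x < x')
    (hrx : (C a - C b * X ^ u + C c * X ^ (u + v) - C e * X ^ (u + v + w) : ℝ[X]).IsRoot x)
    (hrx' : (C a - C b * X ^ u + C c * X ^ (u + v) - C e * X ^ (u + v + w) : ℝ[X]).IsRoot x') :
    ∃ s ∈ Ioo x x', (u : ℝ) * a - (v : ℝ) * c * s ^ (u + v) + ((v : ℝ) + w) * e * s ^ (u + v + w) = 0 := by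
  set P : ℝ[X] := C a - C b * X ^ u + C c * X ^ (u + v) - C e * X ^ (u + v + w) with hPdef
  set h : ℝ → ℝ := fun y => P.eval y / y ^ u with hhdef
  set h' : ℝ → ℝ := fun y => ((derivative P).eval y * y ^ u - P.eval y * ((u : ℝ) * y ^ (u - 1))) / (y ^ u) ^ 2
    with hh'def
  have hcont : ContinuousOn h (Icc x x') := by
    refine ContinuousOn.div (P.continuous).continuousOn (by fun_prop) ?_
    intro y hy
    exact pow_ne_zero _ (hx.trans_le hy.1).ne'
  have hends : h x = h x' := by
    have h1 : P.eval x = 0 := hrx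
    have h2 : P.eval x' = 0 := hrx'
    simp only [hhdef, h1, h2, zero_div]
  have hder : ∀ y ∈ Ioo x x', HasDerivAt h (h' y) y := by
    intro y hy
    have hy0 : y ≠ 0 := (hx.trans hy.1).ne'
    exact (Polynomial.hasDerivAt P y).div (hasDerivAt_pow u y) (pow_ne_zero _ hy0)
  obtain ⟨s, hs, hs0⟩ := exists_hasDerivAt_eq_zero hxx' hcont hends hder
  refine ⟨s, hs, ?_⟩
  have hs0' : 0 < s := hx.trans hs.1
  have hsu : (s ^ u) ^ 2 ≠ 0 := pow_ne_zero _ (pow_ne_zero _ hs0'.ne')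
  have hnum : (derivative P).eval s * s ^ u - P.eval s * ((u : ℝ) * s ^ (u - 1)) = 0 := by
    rcases div_eq_zero_iff.mp hs0 with h0 | h0
    · exact h0
    · exact absurd h0 hsu
  have hsd : s * (derivative P).eval s
      = -(b * (u : ℝ) * s ^ u) + c * ((u : ℝ) + v) * s ^ (u + v) - e * ((u : ℝ) + v + w) * s ^ (u + v + w) := by
    rw [hPdef]; exact mul_eval_derivative_fourNomial a b c e u v w s
  have hPs : P.eval s = a - b * s ^ u + c * s ^ (u + v) - e * s ^ (u + v + w) := by rw [hPdef, eval_fourNomial]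
  -- multiply the numerator by `s`: `s^u · (s·g′(s) − u·g(s)) = 0`
  have hpow : s * s ^ (u - 1) = s ^ u := by rw [← pow_succ', Nat.sub_add_cancel hu]
  have h2 : s * ((derivative P).eval s * s ^ u - P.eval s * ((u : ℝ) * s ^ (u - 1)))
      = s ^ u * (s * (derivative P).eval s - (u : ℝ) * P.eval s) := by
    calc s * ((derivative P).eval s * s ^ u - P.eval s * ((u : ℝ) * s ^ (u - 1)))
        = (s * (derivative P).eval s) * s ^ u - P.eval s * (u : ℝ) * (s * s ^ (u - 1)) := by ring
      _ = s ^ u * (s * (derivative P).eval s - (u : ℝ) * P.eval s) := by rw [hpow]; ring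
  rw [hnum, mul_zero] at h2
  have h3 : s * (derivative P).eval s - (u : ℝ) * P.eval s = 0 := by
    rcases mul_eq_zero.mp h2.symm with h0 | h0
    · exact absurd h0 (pow_ne_zero _ hs0'.ne')
    · exact h0
  have hid : (u : ℝ) * P.eval s - s * (derivative P).eval s
      = (u : ℝ) * a - (v : ℝ) * c * s ^ (u + v) + ((v : ℝ) + w) * e * s ^ (u + v + w) := by
    rw [hsd, hPs]; ring
  linarith

/-- **Counting.**  If every positive root of the window 4-nomial `g` (`a ≠ 0`, `u ≥ 1`) lies in an order-connected set
`J ⊂ (0, ∞)` on which the twist `Φ = u·g − X·g′` is positive, then `g` has at most ONE positive root counted with multiplicity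
(multiple roots and pairs of roots both force a zero of `Φ` in `J`). [folklore] -/
theorem fourNomial_countP_posRoots_le_one_of_twist_pos {u v w : ℕ} (hu : 0 < u) {a b c e : ℝ} (ha : a ≠ 0)
    (J : Set ℝ) (hJ : J.OrdConnected)
    (hroots : ∀ x, 0 < x → (C a - C b * X ^ u + C c * X ^ (u + v) - C e * X ^ (u + v + w) : ℝ[X]).IsRoot x → x ∈ J)
    (hΦ : ∀ y ∈ J, 0 < (u : ℝ) * a - (v : ℝ) * c * y ^ (u + v) + ((v : ℝ) + w) * e * y ^ (u + v + w)) :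
    (C a - C b * X ^ u + C c * X ^ (u + v) - C e * X ^ (u + v + w) : ℝ[X]).roots.countP (fun x => 0 < x) ≤ 1 := by
  classical
  set P : ℝ[X] := C a - C b * X ^ u + C c * X ^ (u + v) - C e * X ^ (u + v + w) with hPdef
  refine le_trans (countP_posRoots_le_card_posRoots_of_rootMultiplicity_le_one P ?_) ?_
  · intro x hx hroot
    by_contra hmul
    have h2 : 1 < P.rootMultiplicity x := by omega
    have hz := fourNomial_twist_eq_zero_of_one_lt_rootMultiplicity (u := u) (v := v) (w := w)
      (a := a) (b := b) (c := c) (e := e) hx h2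
    exact absurd hz (hΦ x (hroots x hx hroot)).ne'
  · refine Finset.card_le_one.mpr ?_
    intro x hx x' hx'
    rw [Finset.mem_filter, Multiset.mem_toFinset] at hx hx'
    have hPne : P ≠ 0 := fourNomial_ne_zero hu ha b c e
    have hrx : P.IsRoot x := (mem_roots hPne).mp hx.1
    have hrx' : P.IsRoot x' := (mem_roots hPne).mp hx'.1
    by_contra hne
    rcases lt_or_gt_of_ne hne with hlt | hlt
    · obtain ⟨s, hs, hs0⟩ := fourNomial_exists_twist_zero_between_roots hu hx.2 hlt hrx hrx'
      have hsJ : s ∈ J := hJ.out (hroots x hx.2 hrx) (hroots x' hx'.2 hrx') ⟨hs.1.le, hs.2.le⟩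
      exact absurd hs0 (hΦ s hsJ).ne'
    · obtain ⟨s, hs, hs0⟩ := fourNomial_exists_twist_zero_between_roots hu hx'.2 hlt hrx' hrx
      have hsJ : s ∈ J := hJ.out (hroots x' hx'.2 hrx') (hroots x hx.2 hrx) ⟨hs.1.le, hs.2.le⟩
      exact absurd hs0 (hΦ s hsJ).ne'

end Summit.ValiantsHypothesis.ValiantsHypothesis.Theorems.LacunarySymmetroidMatrixDescartes.Census
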